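import Literature.Analysis.FluidPDE.NSLerayHopfSereginProfileLeaves
import Literature.Analysis.FluidPDE.RusinSverakLerayExistenceHolds
import Literature.Analysis.FluidPDE.LocalLerayWeakStrongUniquenessHolds
import Literature.Analysis.FluidPDE.LerayL3ExistenceFromFiniteEnergy
import HarnessLib

/-!
# The blow-up profile of Seregin's argument holds (`seregin_blowup_profile`)

Analysis/FluidPDE theorem file (no definition, no named fact): the discharge of the named fact
`Literature.Analysis.FluidPDE.seregin_blowup_profile` (`NSLerayHopfSereginLiminf.lean`; steps
(1)–(5) of the proof of P. G. Lemarié-Rieusset, *The Navier–Stokes Problem in the 21st Century*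
(2016), Thm. 15.5 = G. Seregin, Comm. Math. Phys. 312 (2012), §§2–4: a Kato solution with a
`liminf`-bound in `L³` and a singularity at `(1, 0)` yields a local Leray blow-up profile with
`L³` datum vanishing at the final time).

The accepted reduction `seregin_blowup_profile_of_local_leray_leaves : E → U → K₃ →
seregin_blowup_profile` (`NSLerayHopfSereginProfileLeaves.lean`) consumes three printed theorems,
each of which is by now a theorem of the tree:

* **E** `leray_solution_exists_of_memLp_three_holds` (`RusinSverakLerayExistenceHolds.lean`;
  Lemarié-Rieusset 2016, Thm. 14.8: local Leray solutions for `L³` data);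
* **U** `local_leray_weak_strong_uniqueness_holds` (`LocalLerayWeakStrongUniquenessHolds.lean`;
  Thm. 14.7: weak–strong uniqueness for local Leray solutions);
* **K₃** `jia_sverak_leray_weak_stability_holds` (`LerayL3ExistenceFromFiniteEnergy.lean`;
  Jia–Šverák 2013, proof of Thm. 1: weak `L³` stability with traces).

This file only composes them.

## References

* P. G. Lemarié-Rieusset, *The Navier–Stokes Problem in the 21st Century*, CRC Press (2016),
  doi:10.1201/b19556: Thm. 15.5 and its proof (PDF pp. 570–573), Thm. 14.7, Thm. 14.8.
  [LemarieRieusset2016]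
* G. Seregin, Comm. Math. Phys. 312 (2012) 833–845 = arXiv:1104.3615, Thm. 1.1, §§2–4.
  [Seregin2012CMP]
* H. Jia, V. Šverák, SIAM J. Math. Anal. 45 (2013) = arXiv:1201.1592, proof of Thm. 1.
  [JiaSverak2013]
-/

noncomputable section

namespace Literature.Analysis.FluidPDE

/-- **The blow-up profile of Seregin's argument (`seregin_blowup_profile`) holds** —
Lemarié-Rieusset 2016, proof of Thm. 15.5, steps (1)–(5): the proved reduction
`seregin_blowup_profile_of_local_leray_leaves` applied to the discharged leaves **E**
(Thm. 14.8), **U** (Thm. 14.7) and **K₃** (Jia–Šverák's weak `L³` stability).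
[cite: LemarieRieusset2016, proof of Thm. 15.5, pp. 570–573, with Thm. 14.7 and Thm. 14.8]
[cite: JiaSverak2013, proof of Thm. 1] -/
theorem seregin_blowup_profile_holds : seregin_blowup_profile :=
  seregin_blowup_profile_of_local_leray_leaves leray_solution_exists_of_memLp_three_holds
    local_leray_weak_strong_uniqueness_holds jia_sverak_leray_weak_stability_holds

end Literature.Analysis.FluidPDE

end
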